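import Summits.ResolutionOfSingularities.ResolutionOfSingularities.Theorems.FrobeniusClosingPatchingRelPerfectDepthParamLiftFlat
import Literature.AlgebraicGeometry.Resolution.MonomialOrderReductionUnit
import HarnessLib

/-!
# Crux `PatchingRelPerfect` (stmt-ResolutionOfSingularities-16161), chain W5.2 — F7(β) d = 2 (β-AX), X2a module 2 (M2c), step:
# PARAM-LIFT for the lifted retraction — reduction of `hparam` to the points over the centre

[OURS · L1 W5.2 · F7(β) (β-AX) X-side · res-D-pv-034 AS res-L1-s36-pv-3 per res-L1-w52-plan-1 RULING G11-21 ((M2c) PARAM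
PROPAGATION); interface = the `hparam` hypothesis of res-D-pv-054's M2b `CylState.lift_of` (`D/res-D-pv-054/MultiHostCylLift.lean`).]
Replaces the role of NO printed item; NOT a statement of the manuscript under review; fact-free, def-free.  AI-written; AI review
is weaker than expert review.

Setting (`hparam`): a cylinder state `cyl` over `S`, an E-side centre `C`, a blowing up `τ : X′ → X` along `𝓘(j V(C))`, a blowing
up `τZ : Z′ → Z` along `C`, an open `V′ ⊆ X′` with morphisms `r′ : V′ → Z′`, `φ : V′ → V` such that `φ ≫ ι_V = ι_{V′} ≫ τ`,
`r′ ≫ τZ = φ ≫ q` and `r′^* E_{Z′} = E_{X′}|_{V′}` (the exceptional divisors correspond).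

## Contents
* **`CylState.isParamLiftAt_lift_of_not_mem_centre`** — at a point `y′ ∈ V′` NOT over the pushed centre, `r′` lifts parameters:
  transport of `cyl.param (φ y′)` along the stalk isomorphisms of `φ` and `τZ` there (`IsParamLiftAt.of_stalkIso`).
* **`CylState.isParamLiftAt_lift_of_forall_mem_centre`** — hence `hparam` REDUCES to the points of `V′` over the centre (the
  e-chart points): `(∀ y′ over j V(C), IsParamLiftAt r′ y′) → ∀ y′, IsParamLiftAt r′ y′`.
The e-chart half (flatness with regular one-dimensional fibre of `r′` at the points over the centre, by base change of the Rees
algebra of `C` along the flat `q^♯` and the chart relation `e·T − t`) is the remaining sibling.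

## References
* U. Görtz, T. Wedhorn, *Algebraic Geometry I* (2020), Prop. 13.91 (3). [GortzWedhorn2020]
* H. Matsumura, *Commutative Ring Theory* (1986), Thm. 23.7. [Matsumura1987]
-/

-- `Summit.<Summit>.<Sub>.Theorems` with `Sub = Summit` (single-conjunct summit, D-0017)
set_option linter.dupNamespace false

noncomputable section

open CategoryTheory AlgebraicGeometry TopologicalSpace IsLocalRing
open Literature.AlgebraicGeometry.Resolution
open Scheme.IdealSheafData

namespace Summit.ResolutionOfSingularities.ResolutionOfSingularities.Theorems.DepthMultiHost

universe u

namespace CylState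

variable {X : Scheme.{u}} {S : MultiHostState X} (cyl : CylState S)

section Lift

variable {X' Z' : Scheme.{u}} (C : cyl.Z.IdealSheafData) {τ : X' ⟶ X} (hτ : IsBlowup τ (vanishingIdeal (cyl.centre C)))
  {τZ : Z' ⟶ cyl.Z} (hτZ : IsBlowup τZ C) {V' : X'.Opens} (r' : (V' : Scheme.{u}) ⟶ Z')
  (φ : (V' : Scheme.{u}) ⟶ (cyl.V : Scheme.{u})) (hφ : φ ≫ cyl.V.ι = V'.ι ≫ τ) (hr'τ : r' ≫ τZ = φ ≫ cyl.q)
  (hexc : (C.comap τZ).comap r' = ((vanishingIdeal (cyl.centre C)).comap τ).comap V'.ι)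

include hτ hτZ hφ hr'τ hexc in
/-- [OURS · L1 W5.2 · F7(β) (β-AX) M2c] **PARAM-LIFT for the lifted retraction at a point NOT over the pushed centre**: there `τ` and
`τZ` are local isomorphisms (the point of `Z′` under `r′` is off the exceptional divisor because `r′^* E_{Z′} = E_{X′}|_{V′}`), and
`cyl.param (φ y′)` transports (`IsParamLiftAt.of_stalkIso`). [cite: GortzWedhorn2020, Prop. 13.91 (3)] [cite: Matsumura1987, Thm. 23.7] -/
theorem isParamLiftAt_lift_of_not_mem_centre (y' : (V' : Scheme.{u})) (hy : τ (V'.ι y') ∉ (cyl.centre C : Set X)) :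
    IsParamLiftAt r' y' := by
  -- `τ` is a local isomorphism at `V′.ι y′`
  haveI hτiso : IsIso (τ.stalkMap (V'.ι y')) := by
    refine hτ.isIso_stalkMap_of_not_mem_support (x' := V'.ι y') fun h => hy ?_
    have h' : τ (V'.ι y') ∈ ((vanishingIdeal (cyl.centre C)).support : Set X) := h
    rwa [Scheme.IdealSheafData.coe_support_vanishingIdeal] at h'
  -- hence so is `φ` at `y′`
  haveI hφiso : IsIso (φ.stalkMap y') := by
    haveI h1 : IsIso ((V'.ι ≫ τ).stalkMap y') := by
      rw [Scheme.Hom.stalkMap_comp]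
      exact @IsIso.comp_isIso _ _ _ _ _ _ _ hτiso inferInstance
    haveI h2 : IsIso ((φ ≫ cyl.V.ι).stalkMap y') := by
      rw [Scheme.Hom.stalkMap_congr_hom (φ ≫ cyl.V.ι) (V'.ι ≫ τ) hφ y']; exact IsIso.comp_isIso
    haveI h3 : IsIso (cyl.V.ι.stalkMap (φ y') ≫ φ.stalkMap y') := by
      rw [← Scheme.Hom.stalkMap_comp]; exact h2
    exact IsIso.of_isIso_comp_left (cyl.V.ι.stalkMap (φ y')) (φ.stalkMap y')
  -- `r′ y′` is off the exceptional divisor of `τZ`, so `τZ` is a local isomorphism there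
  haveI hτZiso : IsIso (τZ.stalkMap (r' y')) := by
    refine hτZ.isIso_stalkMap_of_not_mem_support (x' := r' y') fun h => hy ?_
    have h1 : y' ∈ ((C.comap τZ).comap r').support := by
      rw [support_comap, support_comap]; exact h
    rw [hexc, support_comap, support_comap] at h1
    have h2 : τ (V'.ι y') ∈ ((vanishingIdeal (cyl.centre C)).support : Set X) := h1
    rwa [Scheme.IdealSheafData.coe_support_vanishingIdeal] at h2
  exact IsParamLiftAt.of_stalkIso cyl.q r' φ τZ hr'τ y' (cyl.param (φ y'))

include hτ hτZ hφ hr'τ hexc in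
/-- [OURS · L1 W5.2 · F7(β) (β-AX) M2c] **`hparam` reduces to the points over the centre**: if `r′` lifts parameters at every point
of `V′` lying over `j V(C)` (the e-chart points), it lifts parameters everywhere on `V′`. [cite: Matsumura1987, Thm. 23.7] -/
theorem isParamLiftAt_lift_of_forall_mem_centre
    (hchart : ∀ y' : (V' : Scheme.{u}), τ (V'.ι y') ∈ (cyl.centre C : Set X) → IsParamLiftAt r' y')
    (y' : (V' : Scheme.{u})) : IsParamLiftAt r' y' := by
  by_cases hy : τ (V'.ι y') ∈ (cyl.centre C : Set X)
  · exact hchart y' hy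
  · exact cyl.isParamLiftAt_lift_of_not_mem_centre C hτ hτZ r' φ hφ hr'τ hexc y' hy

end Lift

end CylState

end Summit.ResolutionOfSingularities.ResolutionOfSingularities.Theorems.DepthMultiHost

end
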